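import Literature.Barriers.RiemannHypothesis.DavenportHeilbronnHamburgerMellinBarnes
import Mathlib.Analysis.SpecialFunctions.Gamma.Beta
import Mathlib.Analysis.Calculus.Deriv.Polynomial
import Mathlib.Topology.Algebra.Polynomial
import HarnessLib

/-!
# Tools for Hamburger's theorem, V: the Mellin–Barnes integrand and the functional equation

Support file for the discharge of `Literature.Barriers.RiemannHypothesis.Hamburger`
(Titchmarsh, *The Theory of the Riemann Zeta-Function*, §2.13). Everything here is PROVED.

Under the hypotheses of Hamburger's theorem (`f = G/P`, `G` entire of finite order, `P` a
polynomial, `f(s) = ∑ aₙn^{−s}` absolutely convergent for `σ > 1`, and the functional equation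
`f(s)Γ(½s)π^{−½s} = g(1−s)Γ(½−½s)π^{−½(1−s)}`, `g(1−s) = ∑ bₙ n^{s−1}` absolutely convergent for
`σ < −α`) we study the integrand

  `F_τ(w) = f(2w) Γ(w)Γ(1−w) τ^{2w−2}`

of the Mellin–Barnes representation `∑ aₙ/(t²+n²) = (1/2πi)∫_{(c)} F_t(w) dw`
(`DavenportHeilbronnHamburgerMellinBarnes`): the choice of two abscissae `c ∈ (1/2,1)`, `c'`
(`2c' < −α`) and a box containing all singularities between them (`exists_shift_parameters`),
holomorphy off the box, the value `f(2w) = L(a, 2w)` on the right line, and — the heart of the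
matter — the value on the left line given by the functional equation and Legendre's duplication
formula: `F_t(c' + iy) = (2π/t) · L(b, v) (2πt)^{−v} Γ(v)`, `v = 1 − 2w` (`integrand_left_line`).

## References

* [Titchmarsh1986] E. C. Titchmarsh, *The Theory of the Riemann Zeta-Function*, 2nd ed. revised by
  D. R. Heath-Brown, Oxford 1986, §2.13.
-/

noncomputable section

open _root_.Complex Set MeasureTheory Filter Real
open scoped _root_.Topology

namespace Literature.Barriers.RiemannHypothesis

namespace Hamburger1921

open Literature.Analysis.Complex Literature.Analysis.SpecialFunctions

/-! ### Choice of the two abscissae and of the box -/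

/-- **Shift parameters.** For a non-zero polynomial `P` and real `α` there are `c ∈ (1/2, 1)`,
`c'` with `2c' < −α`, `c' ≤ −1/2`, `c' ∉ −ℕ`, and `T > 0`, such that no zero `ρ` of `P` has
`re ρ / 2 ∈ {c, c'}` and every zero has `|im ρ|/2 < T` (so that all singularities of
`G(2w)Γ(w)Γ(1−w)/P(2w)` with `c' ≤ re w ≤ c` lie in the open box `(c', c) × (−T, T)`). [folklore] -/
theorem exists_shift_parameters (P : Polynomial ℂ) (hP : P ≠ 0) (α : ℝ) :
    ∃ c c' T : ℝ, 1 / 2 < c ∧ c < 1 ∧ 2 * c' < -α ∧ c' ≤ -1 / 2 ∧ 0 < T ∧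
      (∀ n : ℕ, c' ≠ -n) ∧
      (∀ ρ : ℂ, P.eval ρ = 0 → ρ.re / 2 ≠ c ∧ ρ.re / 2 ≠ c' ∧ |ρ.im| / 2 < T) := by
  classical
  set bad : Finset ℝ := P.roots.toFinset.image (fun ρ : ℂ ↦ ρ.re / 2) with hbad
  have hbad_spec : ∀ ρ : ℂ, P.eval ρ = 0 → ρ.re / 2 ∈ bad := by
    intro ρ hρ
    rw [hbad, Finset.mem_image]
    exact ⟨ρ, Multiset.mem_toFinset.2 ((Polynomial.mem_roots hP).2 hρ), rfl⟩
  -- the right abscissa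
  obtain ⟨c, hcI, hcbad⟩ :=
    (Ioo_infinite (by norm_num : (1 / 2 : ℝ) < 1)).exists_notMem_finset bad
  -- the left abscissa
  set L : ℝ := min (-α / 2 - 1) (-1) with hL
  set N : ℕ := ⌈1 - L⌉₊ + 1 with hN
  set bad' : Finset ℝ := bad ∪ (Finset.range N).image (fun m : ℕ ↦ -(m : ℝ)) with hbad'
  obtain ⟨c', hc'I, hc'bad⟩ :=
    (Ioo_infinite (by linarith : L - 1 < L)).exists_notMem_finset bad'
  -- the height of the box
  set T : ℝ := 1 + ∑ ρ ∈ P.roots.toFinset, |ρ.im| / 2 with hT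
  have hT0 : 0 < T := by
    have : 0 ≤ ∑ ρ ∈ P.roots.toFinset, |ρ.im| / 2 :=
      Finset.sum_nonneg fun ρ _ ↦ by positivity
    rw [hT]; linarith
  refine ⟨c, c', T, hcI.1, hcI.2, ?_, ?_, hT0, ?_, ?_⟩
  · have : c' < -α / 2 - 1 := hc'I.2.trans_le (min_le_left _ _)
    linarith
  · have : c' < -1 := hc'I.2.trans_le (min_le_right _ _)
    linarith
  · intro n h
    by_cases hn : n < N
    · refine hc'bad ?_
      rw [hbad', Finset.mem_union]
      exact Or.inr (Finset.mem_image.2 ⟨n, Finset.mem_range.2 hn, h.symm⟩)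
    · have hNn : (N : ℝ) ≤ n := by exact_mod_cast not_lt.1 hn
      have hceil : 1 - L ≤ ⌈1 - L⌉₊ := Nat.le_ceil _
      have hNR : (N : ℝ) = ⌈1 - L⌉₊ + 1 := by simp [hN]
      have := hc'I.1
      linarith
  · intro ρ hρ
    have hmem := hbad_spec ρ hρ
    refine ⟨fun h ↦ hcbad (h ▸ hmem), fun h ↦ hc'bad ?_, ?_⟩
    · rw [hbad', Finset.mem_union]
      exact Or.inl (h ▸ hmem)
    · have hρs : ρ ∈ P.roots.toFinset :=
        Multiset.mem_toFinset.2 ((Polynomial.mem_roots hP).2 hρ)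
      have hle : |ρ.im| / 2 ≤ ∑ ρ ∈ P.roots.toFinset, |ρ.im| / 2 :=
        Finset.single_le_sum (f := fun ρ : ℂ ↦ |ρ.im| / 2) (fun ρ _ ↦ by positivity) hρs
      rw [hT]; linarith

/-! ### The integrand away from the box -/

section integrand

variable {a b : ℕ → ℂ} {G : ℂ → ℂ} {P : Polynomial ℂ} {α c c' T : ℝ}

/-- No zero of `P(2w)`, no pole of `Γ(w)` and no pole of `Γ(1 − w)` lies in the closed strip
`c' ≤ re w ≤ c` outside the open box `(c', c) × (−T, T)`. [folklore] -/
theorem no_singularity_of_mem_strip_diff_box (hc0 : 0 < c) (hc1 : c < 1) (hT : 0 < T)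
    (hc'N : ∀ n : ℕ, c' ≠ -n)
    (hroots : ∀ ρ : ℂ, P.eval ρ = 0 → ρ.re / 2 ≠ c ∧ ρ.re / 2 ≠ c' ∧ |ρ.im| / 2 < T)
    {w : ℂ} (hw : w ∈ (re ⁻¹' Icc c' c) \ (Ioo c' c ×ℂ Ioo (-T) T)) :
    P.eval (2 * w) ≠ 0 ∧ (∀ m : ℕ, w ≠ -m) ∧ (∀ m : ℕ, 1 - w ≠ -m) := by
  obtain ⟨hw1, hw2⟩ := hw
  rw [mem_preimage, mem_Icc] at hw1
  rw [mem_reProdIm, mem_Ioo, mem_Ioo] at hw2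
  refine ⟨fun h0 ↦ ?_, fun m hm ↦ ?_, fun m hm ↦ ?_⟩
  · obtain ⟨h1, h2, h3⟩ := hroots _ h0
    have e1 : (2 * w).re = 2 * w.re := by simp
    have e2 : (2 * w).im = 2 * w.im := by simp
    rw [e1, show 2 * w.re / 2 = w.re by ring] at h1 h2
    rw [e2, abs_mul, abs_two, show 2 * |w.im| / 2 = |w.im| by ring, abs_lt] at h3
    exact hw2 ⟨⟨lt_of_le_of_ne hw1.1 (Ne.symm h2), lt_of_le_of_ne hw1.2 h1⟩, h3.1, h3.2⟩
  · have hre : w.re = -m := by rw [hm]; simp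
    have him : w.im = 0 := by rw [hm]; simp
    have hm0 : (0 : ℝ) ≤ m := Nat.cast_nonneg m
    refine hw2 ⟨⟨lt_of_le_of_ne hw1.1 ?_, ?_⟩, ?_, ?_⟩
    · rw [hre]; exact hc'N m
    · rw [hre]; linarith
    · rw [him]; linarith
    · rw [him]; exact hT
  · have := congrArg Complex.re hm
    simp at this
    have hm0 : (0 : ℝ) ≤ m := Nat.cast_nonneg m
    linarith

/-- **Holomorphy of the integrand off the box.** With the parameters of
`exists_shift_parameters`, `F_τ(w) = G(2w)Γ(w)Γ(1−w)τ^{2w−2}/P(2w)` (`τ ≠ 0`, `G` entire) is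
complex differentiable on the closed strip `c' ≤ re w ≤ c` minus the open box. [folklore] -/
theorem differentiableOn_integrand (hG : Differentiable ℂ G) (hc0 : 0 < c) (hc1 : c < 1)
    (hT : 0 < T) (hc'N : ∀ n : ℕ, c' ≠ -n)
    (hroots : ∀ ρ : ℂ, P.eval ρ = 0 → ρ.re / 2 ≠ c ∧ ρ.re / 2 ≠ c' ∧ |ρ.im| / 2 < T)
    {τ : ℂ} (hτ : τ ≠ 0) {F : ℂ → ℂ}
    (hF : ∀ w, F w = G (2 * w) / P.eval (2 * w) * (Complex.Gamma w * Complex.Gamma (1 - w)) *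
      τ ^ (2 * w - 2)) :
    DifferentiableOn ℂ F ((re ⁻¹' Icc c' c) \ (Ioo c' c ×ℂ Ioo (-T) T)) := by
  intro w hw
  obtain ⟨hPw, hΓw, hΓ1w⟩ := no_singularity_of_mem_strip_diff_box hc0 hc1 hT hc'N hroots hw
  have hF' : F = fun w ↦ G (2 * w) / P.eval (2 * w) * (Complex.Gamma w * Complex.Gamma (1 - w)) *
      τ ^ (2 * w - 2) := funext hF
  rw [hF']
  refine DifferentiableAt.differentiableWithinAt ?_
  refine DifferentiableAt.mul (DifferentiableAt.mul ?_ ?_) ?_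
  · refine DifferentiableAt.div ?_ ?_ hPw
    · exact (hG.comp (by fun_prop : Differentiable ℂ fun w : ℂ ↦ 2 * w)).differentiableAt
    · exact (P.differentiable.comp (by fun_prop : Differentiable ℂ fun w : ℂ ↦ 2 * w)).differentiableAt
  · refine DifferentiableAt.mul (Complex.differentiableAt_Gamma _ hΓw) ?_
    exact (Complex.differentiableAt_Gamma _ hΓ1w).comp w (by fun_prop)
  · exact DifferentiableAt.const_cpow (by fun_prop) (Or.inl hτ)

/-- **The integrand on the right line** `re w = c`, `1/2 < c`: there `P(2w) ≠ 0` and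
`G(2w) = P(2w)L(a, 2w)`, so `F_τ(w) = L(a, 2w)Γ(w)Γ(1−w)τ^{2w−2}`. [folklore] -/
theorem integrand_right_line (hc : 1 / 2 < c)
    (ha : ∀ s : ℂ, 1 < s.re → LSeriesSummable a s ∧ P.eval s * LSeries a s = G s)
    (hroots : ∀ ρ : ℂ, P.eval ρ = 0 → ρ.re / 2 ≠ c ∧ ρ.re / 2 ≠ c' ∧ |ρ.im| / 2 < T)
    {τ : ℂ} {F : ℂ → ℂ}
    (hF : ∀ w, F w = G (2 * w) / P.eval (2 * w) * (Complex.Gamma w * Complex.Gamma (1 - w)) *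
      τ ^ (2 * w - 2)) (y : ℝ) :
    P.eval (2 * ((c : ℂ) + y * I)) ≠ 0 ∧
    F (c + y * I) = LSeries a (2 * (c + y * I)) *
      (Complex.Gamma (c + y * I) * Complex.Gamma (1 - (c + y * I)) *
        τ ^ (2 * (c + y * I) - 2)) := by
  have hPw : P.eval (2 * ((c : ℂ) + y * I)) ≠ 0 := by
    intro h0
    have := (hroots _ h0).1
    simp at this
  have h2re : 1 < (2 * ((c : ℂ) + y * I)).re := by simp; linarith
  obtain ⟨-, hGeq⟩ := ha _ h2re
  refine ⟨hPw, ?_⟩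
  rw [hF, ← hGeq, mul_div_cancel_left₀ _ hPw]
  ring

/-! ### The left line: functional equation and duplication -/

/-- A positive real number as an exponential: `p = e^{log p}` in `ℂ`. [folklore] -/
theorem ofReal_eq_exp_log {p : ℝ} (hp : 0 < p) : (p : ℂ) = Complex.exp (Real.log p) := by
  rw [← Complex.ofReal_exp, Real.exp_log hp]

/-- Bookkeeping of powers on the left line: for `t > 0`,
`2^{2w} √π π^{−(1−2w)/2} (π^{−w})⁻¹ t^{2w−2} = (2π/t) (2πt)^{−(1−2w)}`. [folklore] -/
theorem left_line_powers {t : ℝ} (ht : 0 < t) (w : ℂ) :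
    (2 : ℂ) ^ (2 * w) * (Real.sqrt π : ℂ) * (π : ℂ) ^ (-(1 - 2 * w) / 2) *
        ((π : ℂ) ^ (-w))⁻¹ * (t : ℂ) ^ (2 * w - 2) =
      (2 * π / t : ℂ) * ((2 * π * t : ℝ) : ℂ) ^ (-(1 - 2 * w)) := by
  have hπ := Real.pi_pos
  have h2πt : 0 < 2 * π * t := by positivity
  -- everything as exponentials of real logarithms
  have hlog2 : Complex.log 2 = (Real.log 2 : ℝ) := by
    rw [show (2 : ℂ) = ((2 : ℝ) : ℂ) by norm_num, ← Complex.ofReal_log zero_le_two]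
  have e2 : (2 : ℂ) ^ (2 * w) = Complex.exp (2 * w * Real.log 2) := by
    rw [Complex.cpow_def_of_ne_zero two_ne_zero, hlog2, mul_comm]
  have esqrt : (Real.sqrt π : ℂ) = Complex.exp ((Real.log π / 2 : ℝ)) := by
    rw [← Complex.ofReal_exp, Real.sqrt_eq_rpow, Real.rpow_def_of_pos hπ]
    congr 1; ring
  have hlogmul : Real.log (2 * π * t) = Real.log 2 + Real.log π + Real.log t := by
    rw [Real.log_mul (by positivity) ht.ne', Real.log_mul two_ne_zero hπ.ne']
  have e2πt : (2 * π / t : ℂ) = Complex.exp (Real.log 2 + Real.log π - Real.log t) := by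
    rw [Complex.exp_sub, Complex.exp_add, ← ofReal_eq_exp_log two_pos, ← ofReal_eq_exp_log hπ,
      ← ofReal_eq_exp_log ht]
    push_cast
    ring
  rw [e2, esqrt, ofReal_cpow_eq_exp hπ, ofReal_cpow_eq_exp hπ, ofReal_cpow_eq_exp ht,
    ofReal_cpow_eq_exp h2πt, hlogmul, e2πt, ← Complex.exp_neg, ← Complex.exp_add,
    ← Complex.exp_add, ← Complex.exp_add, ← Complex.exp_add, ← Complex.exp_add]
  congr 1
  push_cast
  ring

/-- Legendre's duplication formula in the form `Γ(½ − w)Γ(1 − w) = Γ(1 − 2w) 2^{2w} √π`.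
[folklore] -/
theorem Gamma_half_sub_mul_Gamma_one_sub (w : ℂ) :
    Complex.Gamma (1 / 2 - w) * Complex.Gamma (1 - w) =
      Complex.Gamma (1 - 2 * w) * (2 : ℂ) ^ (2 * w) * (Real.sqrt π : ℂ) := by
  have h := Complex.Gamma_mul_Gamma_add_half (1 / 2 - w)
  rw [show (1 : ℂ) - w = 1 / 2 - w + 1 / 2 by ring, show (1 : ℂ) - 2 * w = 2 * (1 / 2 - w) by ring,
    show (2 : ℂ) * w = 1 - 2 * (1 / 2 - w) by ring]
  exact h

/-- **The integrand on the left line** `re w = c'` (`2c' < −α`, `c' ∉ −ℕ`, no zero of `P(2w)`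
on the line): the functional equation `f(2w)Γ(w)π^{−w} = L(b, 1−2w)Γ(½−w)π^{−(1−2w)/2}` and
Legendre's duplication formula give, for `t > 0` and `v = 1 − 2w = (1 − 2c') − 2iy`,
`F_t(c' + iy) = (2π/t) · L(b, v) (2πt)^{−v} Γ(v)`
(Titchmarsh §2.13: "by (2.13.2) … we move the line of integration … to `σ = −1 − α`").
[cite: Titchmarsh1986, §2.13] -/
theorem integrand_left_line (hc'α : 2 * c' < -α) (hc'N : ∀ n : ℕ, c' ≠ -n)
    (hroots : ∀ ρ : ℂ, P.eval ρ = 0 → ρ.re / 2 ≠ c ∧ ρ.re / 2 ≠ c' ∧ |ρ.im| / 2 < T)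
    (hfe : ∀ s : ℂ, s.re < -α → P.eval s ≠ 0 → (∀ n : ℕ, s ≠ -(2 * (n : ℂ))) →
      G s / P.eval s * Complex.Gamma (s / 2) * (π : ℂ) ^ (-s / 2) =
        LSeries b (1 - s) * Complex.Gamma (1 / 2 - s / 2) * (π : ℂ) ^ (-(1 - s) / 2))
    {t : ℝ} (ht : 0 < t) {F : ℂ → ℂ}
    (hF : ∀ w, F w = G (2 * w) / P.eval (2 * w) * (Complex.Gamma w * Complex.Gamma (1 - w)) *
      (t : ℂ) ^ (2 * w - 2)) (y : ℝ) :
    F (c' + y * I) = (2 * π / t : ℂ) *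
      (LSeries b (((1 - 2 * c' : ℝ) : ℂ) + (((-2) * y : ℝ) : ℂ) * I) *
        ((((2 * π * t : ℝ)) : ℂ) ^ (-((((1 - 2 * c' : ℝ) : ℂ)) + (((-2) * y : ℝ) : ℂ) * I)) *
          Complex.Gamma ((((1 - 2 * c' : ℝ) : ℂ)) + (((-2) * y : ℝ) : ℂ) * I))) := by
  set w : ℂ := (c' : ℂ) + y * I with hw
  have hv : (((1 - 2 * c' : ℝ) : ℂ)) + (((-2) * y : ℝ) : ℂ) * I = 1 - 2 * w := by
    rw [hw]; push_cast; ring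
  rw [hv]
  -- hypotheses of the functional equation at `s = 2w`
  have hPw : P.eval (2 * w) ≠ 0 := by
    intro h0
    have := (hroots _ h0).2.1
    simp [hw] at this
  have hre : (2 * w).re < -α := by simp [hw]; linarith
  have h2n : ∀ n : ℕ, 2 * w ≠ -(2 * (n : ℂ)) := by
    intro n h
    have h1 := congrArg Complex.re h
    simp [hw] at h1
    exact hc'N n (by linarith)
  have hΓw : Complex.Gamma w ≠ 0 := by
    refine Complex.Gamma_ne_zero fun m hm ↦ ?_
    have h1 := congrArg Complex.re hm
    simp [hw] at h1
    exact hc'N m h1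
  have hπ0 : (π : ℂ) ≠ 0 := ofReal_ne_zero.2 Real.pi_ne_zero
  have hπw : (π : ℂ) ^ (-w) ≠ 0 := by
    rw [Complex.cpow_def_of_ne_zero hπ0]; exact Complex.exp_ne_zero _
  have hFE := hfe (2 * w) hre hPw h2n
  rw [show 2 * w / 2 = w by ring, show -(2 * w) / 2 = -w by ring] at hFE
  -- solve the functional equation for `G(2w)/P(2w)`
  have hGP : G (2 * w) / P.eval (2 * w) = LSeries b (1 - 2 * w) * Complex.Gamma (1 / 2 - w) *
      (π : ℂ) ^ (-(1 - 2 * w) / 2) / (Complex.Gamma w * (π : ℂ) ^ (-w)) := by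
    rw [eq_div_iff (mul_ne_zero hΓw hπw), ← hFE]; ring
  have step : F w = LSeries b (1 - 2 * w) *
      (Complex.Gamma (1 / 2 - w) * Complex.Gamma (1 - w)) *
        ((π : ℂ) ^ (-(1 - 2 * w) / 2) * ((π : ℂ) ^ (-w))⁻¹ * (t : ℂ) ^ (2 * w - 2)) := by
    rw [hF w, hGP]
    field_simp
  rw [step, Gamma_half_sub_mul_Gamma_one_sub]
  linear_combination (LSeries b (1 - 2 * w) * Complex.Gamma (1 - 2 * w)) * left_line_powers ht w

end integrand

end Hamburger1921

end Literature.Barriers.RiemannHypothesis
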